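import Mathlib.GroupTheory.SemidirectProduct
import Mathlib.Algebra.Group.Subgroup.ZPowers.Basic
import Mathlib.Algebra.Group.Subgroup.Map
import Mathlib.Algebra.Group.Commute.Hom
import Mathlib.Algebra.Group.Int.TypeTags
import Mathlib.Tactic.Group
import Mathlib.Tactic.LinearCombination
import Mathlib.Algebra.BigOperators.Finprod
import Mathlib.Data.Real.Basic
import HarnessLib

/-!
# Kottwitz 1986 (Compositio), §1 «Main result»: base change for the unit elements of Hecke algebras (typed; the group theory concrete)

R. E. Kottwitz, *Base change for unit elements of Hecke algebras*, Compositio Math. 60 (1986) 237–250 [Kottwitz1986BaseChangeUnits],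
§1 «Main result», pp. 239–244.  Source: the open NUMDAM copy (item CM_1986__60_2_237_0; lit key `paper:url-52c464c05c51`, PDF page
n = printed p. 235+n), read on the page IMAGES `T/KOT/TK-t12/g0/Kottwitz1986BaseChangeUnits-NUMDAM/img/p0239.png … p0244.png` decoded
by the source steward TK-t12 (cell `pub/hodgecm-mathlib`, squad TK); quotations AS PRINTED.  Carpet file (seat TK-t08, co-deal with TK-t12,
whose `UnitBaseChange.lean` carries the Introduction's set-up pp. 237–239 and §§2–4): STATEMENTS (edition 1) plus, in EDITION 2, in-file
PROOFS of the twelve group-theoretic §1 predicates (section «Discharges» at the end: `FixedCosets_sigma_holds`, …, `fixedCoset_transport_holds`,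
each `theorem X_holds : ∀ …, X …`, from Mathlib's `SemidirectProduct` / `MulAut` API through the generation identity
`⟨γ^aσ^l, γ^bσ^j⟩ = ⟨γ, σ⟩` for `bl − aj = 1`, `pair_gen_fst` / `pair_gen_snd`); no `sorry`, no axiom, no instance, no notation.  The
orbital-integral layer stays a typed skeleton (nothing asserted there).

WHAT IS TYPED, AND HOW.  §1 is, until its last page, pure group theory inside the semidirect product `G(L) ⋊ ⟨σ⟩`, and is typed
CONCRETELY over Mathlib (`SemidirectProduct`, `MulAut`, `Subgroup`): an abstract group `GL` (= `G(L)`) with an automorphism `σ` (Frobenius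
of `L/F`), `G(F)` = the `σ`-fixed elements, `G(E)` = the `σ^l`-fixed elements, `θ = σ^j` on `G(E)`, integers `a, b` with `bl − aj = 1`, an
open bounded subgroup `K_L ≤ G(L)` with the printed conditions (a), (b), (c) (`KLCondA/B/C`), `K = G(F) ∩ K_L`, `K_E = G(E) ∩ K_L`, the coset
spaces `X ⊂ X_E ⊂ X_L = G(L)/K_L` handled through representatives (`g K_L` is `σ`-fixed iff `g⁻¹σ(g) ∈ K_L`).  Typed with bodies: the
correspondence `γ ↔ δ` by (A), (B) (`Corr`), the norm `Nδ = (δσ^j)^l σ^{−jl}` (`normElt`), `θ`-conjugacy and `G(F)`-conjugacy; as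
predicates with explicit parameters (nothing asserted BY THE DEFINITIONS; all twelve PROVED in section «Discharges», edition 2): the fixed-point descriptions of
p. 240 (`FixedCosets_sigma`, `FixedCosets_sigmaPow`), (A)(B) ⟺ (A′)(B′) (`corr_iff_primed`), (C′) (`norm_eq_conj`), «`δ` exists iff (A′) can be
solved» and its `θ`-conjugacy clause (`exists_delta_iff`, `corr_delta_unique`), «`γ` exists iff (D′) can be solved» and its conjugacy clause
(`exists_gamma_iff`, `corr_gamma_unique`), the two existence statements of p. 242 (`exists_delta_of_fixedCoset`, `exists_gamma_of_fixedCoset`),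
and the transport statements of p. 241 (`centralizer_transport`, `fixedCoset_transport`).  The ORBITAL-INTEGRAL layer (Haar measures,
`O_γ(f)`, `O_{δθ}(f_E)`, stable integrals, the signs `e(·)`) is a TYPED SKELETON over the hypothesis structure `OrbitalDatum` (parallel posit
of the carriers TK-t12's `UnitBaseChange.lean` introduces for the Introduction; consolidation by import in a later edition): the sum formulas
of p. 240 (`Eq240E`, `Eq240F`), «`O_γ(f) ≠ 0` iff `X^γ` is non-empty» (`orb_ne_zero_iff`), the **THEOREM** (p. 243, `Theorem`), the equality
of signs (`signs_equal`), the **COROLLARY** and its supplement (p. 244, `Corollary`, `Supplement`).  NOTHING IS ASSERTED.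

THE PRINT.  (p. 239–240) «Let `F`, `E`, `θ`, `l` be as before. In particular we still insist that `E/F` be unramified. Let `L` denote the
completion of the maximal unramified extension `E^un` of `E`. We have `E^un = F^un` and we denote by `σ` the Frobenius automorphism of `L`
over `F`. Let `G` be a connected reductive group over `F`, no longer assumed to be unramified. We do assume, however, that `G_der` is simply
connected. […] Let `K_L` be an open bounded subgroup of `G(L)` satisfying the following three conditions: (a) `σ(K_L) = K_L`. (b) The mapping
`k ↦ k⁻¹σ(k)` from `K_L` to `K_L` is surjective. (c) The mapping `k ↦ k⁻¹σ^l(k)` from `K_L` to `K_L` is surjective. Let `K` (resp. `K_E`) be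
`G(F) ∩ K_L` (resp. `G(E) ∩ K_L`). […] Let `X`, `X_E`, `X_L` denote `G(F)/K`, `G(E)/K_E`, `G(L)/K_L` respectively. There are obvious inclusions
`X ⊂ X_E ⊂ X_L` and `σ` acts on `X_L`. Condition (b) (resp. (c)) implies that the fixed point set of `σ` (resp. `σ^l`) on `X_L` is equal to `X`
(resp. `X_E`). Choose Haar measures `dg`, `dg_E` on `G(F)`, `G(E)` such that `K`, `K_E` have measure `1` […]. Let `f` (resp. `f_E`) denote the
characteristic function of `K` (resp. `K_E`) […]. Let `δ ∈ G(E)`. Then `O_{δθ}(f_E) = Σ_g meas(I_{δθ}(F)\I_{δθ}(F)gK_E)`, where `g` runs over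
a set of representatives for the elements of `I_{δθ}(F)\G(E)/K_E` such that `g⁻¹δθ(g) ∈ K_E`. […] we have shown that
`O_{δθ}(f_E) = Σ_x meas(I_{δθ}(F)_x)⁻¹`, where `x` runs through a set of representatives for the orbits of `I_{δθ}(F)` on `X_E^{δθ}`. Taking
the special case `E = F`, we get a corollary that for `γ ∈ G(F)` `O_γ(f) = Σ_x meas(G_γ(F)_x)⁻¹`, where `x` runs through a set of
representatives for the orbits of `G_γ(F)` on `X^γ`, the set of fixed points of `γ` on `X`.»  (p. 241) «Choose an integer `j` such that `θ`
is equal to the restriction of `σ^j` to `E`. Of course `j` is relatively prime to `l`, and hence we can choose integers `a`, `b` such that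
`bl − aj = 1`. […] Let `γ ∈ G(F)` and `δ ∈ G(E)`. We write `γ ↔ δ` if there exists `c ∈ G(L)` such that the following two conditions hold:
(A) `cγ^aσ^lc⁻¹ = σ^l`, (B) `cγ^bσ^jc⁻¹ = δσ^j`. In (A) and (B) the equalities are of elements in the semidirect product of `G(L)` and the
infinite cyclic group `⟨σ⟩` generated by `σ`. […] Taking `Y = X_L`, we see that `x ↦ cx` induces a bijection from `X^γ` to `X_E^{δθ}`. Taking
`Y = G(L)` with `G(L)` acting by conjugation, we see that `g ↦ cgc⁻¹` induces an isomorphism from `G_γ(F)` to `I_{δθ}(F)`. It is then immediate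
from the expressions we obtained for `O_{δθ}(f_E)` and `O_γ(f)` that `O_{δθ}(f_E) = O_γ(f)` if the measures used on `G_γ(F)`, `I_{δθ}(F)`
correspond under the isomorphism above. […] Conditions (A), (B) can be rewritten as (A′) `γ^a = c⁻¹σ^l(c)`, (B′) `δ = cγ^bσ^j(c⁻¹)`. If `δ`
exists, then (A′) can be solved. Conversely, suppose that (A′) can be solved. Then we can use (B′) to define `δ ∈ G(L)` such that `γ, δ, c`
satisfy (A), (B). But then `c⟨γ, σ⟩c⁻¹ = ⟨σ^l, δσ^j⟩`, which implies that `σ^l`, `δσ^j` commute, and this in turn implies that `δ ∈ G(E)`. We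
conclude that `δ` exists if and only if (A′) can be solved. […] Thus if `γ ↔ δ`, then `γ ↔ δ′` if and only if `δ, δ′` are `θ`-conjugate under
`G(E)`.»  (p. 242) «we see that (A), (B) are equivalent to (C) `(δσ^j)^lσ^{−jl} = cγc⁻¹`, (D) `(δσ^j)^{−a}σ^{bl} = cσc⁻¹` (of course we are using
that `γ, σ` commute and that `σ^l, δσ^j` commute). We can rewrite (C), (D) as (C′) `Nδ = cγc⁻¹`, (D′) `(δσ^j)^{−a}σ^{aj} = cσ(c⁻¹)`. […] We conclude
that `γ` exists if and only if (D′) can be solved. […] Thus if `γ ↔ δ`, then `γ′ ↔ δ` if and only if `γ, γ′` are conjugate in `G(F)`. […] The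
correspondence sets up a bijection from the set of conjugacy classes in `G(F)` of elements `γ ∈ G(F)` such that (A′) can be solved to the set
of `θ`-conjugacy classes in `G(E)` of elements `δ ∈ G(E)` such that (D′) can be solved. Furthermore (C′) tells us that if `γ ↔ δ`, then
`𝒩δ = γ`. […] First we show that if `γ ∈ G(F)` and `X^γ` is non-empty, then there exists `δ ∈ G(E)` such that `γ ↔ δ`. […] Next we show that if
`δ ∈ G(E)` and `X_E^{δθ}` is non-empty, then there exists `γ ∈ G(F)` such that `γ ↔ δ`.»  (p. 243) «THEOREM: The correspondence `γ ↔ δ`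
induces a bijection from the set of conjugacy classes of `γ ∈ G(F)` such that `O_γ(f) ≠ 0` to the set of `θ`-conjugacy classes of
`δ ∈ G(E)` such that `O_{δθ}(f_E) ≠ 0`. Moreover if `γ ↔ δ`, then `γ = 𝒩δ`, `G_γ(F)` is isomorphic to `I_{δθ}(F)`, and `O_γ(f) = O_{δθ}(f_E)`.
Since `O_γ(f) ≠ 0` (resp. `O_{δθ}(f_E) ≠ 0`) if and only if `X^γ` (resp. `X_E^{δθ}`) is non-empty, the theorem follows from the remarks made
above. […] This will show that if we use `g ↦ c⁻¹gc` to transport a Haar measure on `I_{δθ}(F)` over to `G_γ(F)`, the two measures will be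
compatible in the sense that arises in the definition of matching orbital integrals. It will also show that the signs `e(G_γ)` and
`e(I_{δθ})` are equal.»  (p. 244) «COROLLARY: The functions `f`, `f_E` have matching orbital integrals. […] Nevertheless the corollary is true
and even has the following supplement: if `𝒩δ` does not exist in `G(F)`, then `SO_{δθ}(f_E) = 0`.»  (p. 239, the definition used: «we say
that `f_E`, `f` have matching orbital integrals if for every semisimple `γ ∈ G(F)` the stable orbital integral `SO_γ(f)` vanishes unless the
stable conjugacy class of `γ` is equal to `𝒩δ` for some `δ ∈ G(E)`, in which case it is given by `SO_γ(f) = SO_{δθ}(f_E)`».)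

NOT typed: the «technical point» of pp. 243–244 beyond its two consequences (the `F`-isomorphism `α : I_{δθ} ⥲ G_γ` with `α = Int(c)⁻¹ ∘ p`
and the Galois computation `σ^j(α) = σ^l(α) = α`); the Introduction (pp. 237–239: `ℋ`, `ℋ_E`, the base-change homomorphism `b`, the norm
`𝒩`, stable integrals) and §§2–4 — TK-t12's `UnitBaseChange.lean`.  HC_CM is proved only modulo the printed citations until rung 0 closes;
this file discharges none of them.

## References
* [Kottwitz1986BaseChangeUnits] R. E. Kottwitz, *Base change for unit elements of Hecke algebras*, Compositio Math. 60 (1986) 237–250,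
  §1 pp. 239–244: conditions (a)–(c) and the orbital-integral formulas p. 240; (A), (B), (A′), (B′) p. 241; (C), (D), (C′), (D′) p. 242;
  THEOREM p. 243; COROLLARY and supplement p. 244; the definition of matching orbital integrals p. 239.
* [Kottwitz1983] R. E. Kottwitz, *Sign changes in harmonic analysis on reductive groups* (the signs `e(G_γ)`, `e(I_{δθ})`; tree:
  `Literature/NumberTheory/Kottwitz1983/SignChanges.lean`).
-/

open SemidirectProduct

namespace Literature.NumberTheory.Kottwitz1986BaseChangeUnits.MainResult

universe u v

section GroupTheory

variable {GL : Type u} [Group GL]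

/-! ## The semidirect product `G(L) ⋊ ⟨σ⟩` and the standing objects of §1 (pp. 239–241) -/

/-- The action `n ↦ σ^n` of the infinite cyclic group `⟨σ⟩ ≅ ℤ` on `G(L)`. [cite: Kottwitz1986BaseChangeUnits, §1 (p. 241)] -/
noncomputable def frobHom (σ : MulAut GL) : Multiplicative ℤ →* MulAut GL :=
  zpowersHom (MulAut GL) σ

/-- «the semidirect product of `G(L)` and the infinite cyclic group `⟨σ⟩` generated by `σ`» (p. 241), as Mathlib's `SemidirectProduct`.
[cite: Kottwitz1986BaseChangeUnits, §1 (p. 241)] -/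
abbrev SD (σ : MulAut GL) : Type u :=
  GL ⋊[frobHom σ] Multiplicative ℤ

/-- The element `σ` of `G(L) ⋊ ⟨σ⟩`. [cite: Kottwitz1986BaseChangeUnits, §1 (p. 241)] -/
noncomputable def frobElt (σ : MulAut GL) : SD σ :=
  inr (Multiplicative.ofAdd (1 : ℤ))

/-- `G(F)` = the elements of `G(L)` fixed by `σ` («the Frobenius automorphism of `L` over `F`», p. 239). [cite: Kottwitz1986BaseChangeUnits, §1 (p. 239)] -/
def IsRatF (σ : MulAut GL) (g : GL) : Prop :=
  σ g = g

/-- `G(E)` = the elements of `G(L)` fixed by `σ^l` (`[E : F] = l`, `E/F` unramified, `E^un = F^un`, p. 239).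
[cite: Kottwitz1986BaseChangeUnits, §1 (p. 239)] -/
def IsRatE (σ : MulAut GL) (l : ℕ) (g : GL) : Prop :=
  (σ ^ l) g = g

/-- Condition (a) on `K_L` (p. 240): «`σ(K_L) = K_L`». [cite: Kottwitz1986BaseChangeUnits, §1 (a) (p. 240)] -/
def KLCondA (σ : MulAut GL) (KL : Subgroup GL) : Prop :=
  KL.map σ.toMonoidHom = KL

/-- Condition (b) on `K_L` (p. 240): «The mapping `k ↦ k⁻¹σ(k)` from `K_L` to `K_L` is surjective.» [cite: Kottwitz1986BaseChangeUnits, §1 (b) (p. 240)] -/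
def KLCondB (σ : MulAut GL) (KL : Subgroup GL) : Prop :=
  ∀ k' ∈ KL, ∃ k ∈ KL, k⁻¹ * σ k = k'

/-- Condition (c) on `K_L` (p. 240): «The mapping `k ↦ k⁻¹σ^l(k)` from `K_L` to `K_L` is surjective.» [cite: Kottwitz1986BaseChangeUnits, §1 (c) (p. 240)] -/
def KLCondC (σ : MulAut GL) (l : ℕ) (KL : Subgroup GL) : Prop :=
  ∀ k' ∈ KL, ∃ k ∈ KL, k⁻¹ * (σ ^ l) k = k'

/-- «Condition (b) […] implies that the fixed point set of `σ` […] on `X_L` is equal to `X`» (p. 240), through representatives: under (a), (b),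
the coset `gK_L ∈ X_L = G(L)/K_L` is `σ`-fixed (`g⁻¹σ(g) ∈ K_L`) iff it has a representative in `G(F)` (i.e. lies in `X = G(F)/K`,
`K = G(F) ∩ K_L`).  Provable as stated; nothing is asserted. [cite: Kottwitz1986BaseChangeUnits, §1 (p. 240)] -/
def FixedCosets_sigma (σ : MulAut GL) (KL : Subgroup GL) : Prop :=
  KLCondA σ KL → KLCondB σ KL →
    ∀ g : GL, g⁻¹ * σ g ∈ KL ↔ ∃ h : GL, IsRatF σ h ∧ h⁻¹ * g ∈ KL

/-- «Condition […] (c) implies that the fixed point set of […] `σ^l` on `X_L` is equal to […] `X_E`» (p. 240), through representatives as in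
`FixedCosets_sigma`.  Provable as stated; nothing is asserted. [cite: Kottwitz1986BaseChangeUnits, §1 (p. 240)] -/
def FixedCosets_sigmaPow (σ : MulAut GL) (l : ℕ) (KL : Subgroup GL) : Prop :=
  KLCondA σ KL → KLCondC σ l KL →
    ∀ g : GL, g⁻¹ * (σ ^ l) g ∈ KL ↔ ∃ h : GL, IsRatE σ l h ∧ h⁻¹ * g ∈ KL

/-! ## The correspondence `γ ↔ δ` (pp. 241–242) -/

/-- Conditions (A), (B) for given `γ, δ, c` (p. 241): «(A) `cγ^aσ^lc⁻¹ = σ^l`, (B) `cγ^bσ^jc⁻¹ = δσ^j`» in `G(L) ⋊ ⟨σ⟩`.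
[cite: Kottwitz1986BaseChangeUnits, §1 (A), (B) (p. 241)] -/
def CondAB (σ : MulAut GL) (l j : ℕ) (a b : ℤ) (γ δ c : GL) : Prop :=
  inl c * inl γ ^ a * frobElt σ ^ l * (inl c)⁻¹ = frobElt σ ^ l ∧
    inl c * inl γ ^ b * frobElt σ ^ j * (inl c)⁻¹ = inl δ * frobElt σ ^ j

/-- **`γ ↔ δ`** (p. 241): «We write `γ ↔ δ` if there exists `c ∈ G(L)` such that the following two conditions hold: (A) […] (B) […]», for
`γ ∈ G(F)`, `δ ∈ G(E)`. [cite: Kottwitz1986BaseChangeUnits, §1 (p. 241)] -/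
def Corr (σ : MulAut GL) (l j : ℕ) (a b : ℤ) (γ δ : GL) : Prop :=
  ∃ c : GL, CondAB σ l j a b γ δ c

/-- The norm `Nδ := (δσ^j)^l σ^{−jl} ∈ G(L)` (= `δθ(δ)⋯θ^{l−1}(δ)`, `θ = σ^j`; (C), (C′) p. 242), as the `G(L)`-component of that element of
`G(L) ⋊ ⟨σ⟩`. [cite: Kottwitz1986BaseChangeUnits, §1 (C′) (p. 242)] -/
noncomputable def normElt (σ : MulAut GL) (l j : ℕ) (δ : GL) : GL :=
  ((inl δ * frobElt σ ^ j) ^ l * (frobElt σ ^ (j * l))⁻¹).left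

/-- `δ, δ′ ∈ G(E)` are `θ`-conjugate under `G(E)` (`θ = σ^j`): `δ′ = gδθ(g)⁻¹` for some `g ∈ G(E)` (p. 241).
[cite: Kottwitz1986BaseChangeUnits, §1 (p. 241)] -/
def IsThetaConj (σ : MulAut GL) (l j : ℕ) (δ δ' : GL) : Prop :=
  ∃ g : GL, IsRatE σ l g ∧ δ' = g * δ * ((σ ^ j) g)⁻¹

/-- `γ, γ′ ∈ G(F)` are conjugate in `G(F)` (p. 242). [cite: Kottwitz1986BaseChangeUnits, §1 (p. 242)] -/
def IsConjF (σ : MulAut GL) (γ γ' : GL) : Prop :=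
  ∃ g : GL, IsRatF σ g ∧ γ' = g * γ * g⁻¹

/-- (A), (B) ⟺ (A′), (B′) (p. 241): «Conditions (A), (B) can be rewritten as (A′) `γ^a = c⁻¹σ^l(c)`, (B′) `δ = cγ^bσ^j(c⁻¹)`.»  Provable
as stated (multiplication in the semidirect product); nothing is asserted. [cite: Kottwitz1986BaseChangeUnits, §1 (A′), (B′) (p. 241)] -/
def corr_iff_primed (σ : MulAut GL) (l j : ℕ) (a b : ℤ) : Prop :=
  ∀ γ δ c : GL, CondAB σ l j a b γ δ c ↔ (γ ^ a = c⁻¹ * (σ ^ l) c ∧ δ = c * γ ^ b * (σ ^ j) c⁻¹)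

/-- (C′) (p. 242): for `γ ∈ G(F)`, `δ ∈ G(E)`, `bl − aj = 1` and `c` with (A), (B): «`Nδ = cγc⁻¹`» («of course we are using that `γ, σ` commute
and that `σ^l, δσ^j` commute»).  Provable as stated; nothing is asserted. [cite: Kottwitz1986BaseChangeUnits, §1 (C′) (p. 242)] -/
def norm_eq_conj (σ : MulAut GL) (l j : ℕ) (a b : ℤ) : Prop :=
  b * l - a * j = 1 → ∀ γ δ c : GL, IsRatF σ γ → IsRatE σ l δ → CondAB σ l j a b γ δ c →
    normElt σ l j δ = c * γ * c⁻¹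

/-- «`δ` exists if and only if (A′) can be solved» (p. 241): for `γ ∈ G(F)` and `bl − aj = 1`, there is `δ ∈ G(E)` with `γ ↔ δ` iff
`γ^a = c⁻¹σ^l(c)` for some `c ∈ G(L)`.  Provable as stated; nothing is asserted. [cite: Kottwitz1986BaseChangeUnits, §1 (p. 241)] -/
def exists_delta_iff (σ : MulAut GL) (l j : ℕ) (a b : ℤ) : Prop :=
  b * l - a * j = 1 → ∀ γ : GL, IsRatF σ γ →
    ((∃ δ : GL, IsRatE σ l δ ∧ Corr σ l j a b γ δ) ↔ ∃ c : GL, γ ^ a = c⁻¹ * (σ ^ l) c)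

/-- «Thus if `γ ↔ δ`, then `γ ↔ δ′` if and only if `δ, δ′` are `θ`-conjugate under `G(E)`» (p. 241), for `γ ∈ G(F)`, `δ, δ′ ∈ G(E)`.
Nothing is asserted. [cite: Kottwitz1986BaseChangeUnits, §1 (p. 241)] -/
def corr_delta_unique (σ : MulAut GL) (l j : ℕ) (a b : ℤ) : Prop :=
  b * l - a * j = 1 → ∀ γ δ δ' : GL, IsRatF σ γ → IsRatE σ l δ → IsRatE σ l δ' → Corr σ l j a b γ δ →
    (Corr σ l j a b γ δ' ↔ IsThetaConj σ l j δ δ')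

/-- «`γ` exists if and only if (D′) can be solved» (p. 242): for `δ ∈ G(E)` and `bl − aj = 1`, there is `γ ∈ G(F)` with `γ ↔ δ` iff
(D′) «`(δσ^j)^{−a}σ^{aj} = cσ(c⁻¹)`» for some `c ∈ G(L)` (left side computed in `G(L) ⋊ ⟨σ⟩`; its `⟨σ⟩`-component is trivial).  Nothing is
asserted. [cite: Kottwitz1986BaseChangeUnits, §1 (D′) (p. 242)] -/
def exists_gamma_iff (σ : MulAut GL) (l j : ℕ) (a b : ℤ) : Prop :=
  b * l - a * j = 1 → ∀ δ : GL, IsRatE σ l δ →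
    ((∃ γ : GL, IsRatF σ γ ∧ Corr σ l j a b γ δ) ↔
      ∃ c : GL, (inl δ * frobElt σ ^ j) ^ (-a) * frobElt σ ^ ((a : ℤ) * j) = (inl (c * σ c⁻¹) : SD σ))

/-- «Thus if `γ ↔ δ`, then `γ′ ↔ δ` if and only if `γ, γ′` are conjugate in `G(F)`» (p. 242).  Nothing is asserted.
[cite: Kottwitz1986BaseChangeUnits, §1 (p. 242)] -/
def corr_gamma_unique (σ : MulAut GL) (l j : ℕ) (a b : ℤ) : Prop :=
  b * l - a * j = 1 → ∀ γ γ' δ : GL, IsRatF σ γ → IsRatF σ γ' → IsRatE σ l δ → Corr σ l j a b γ δ →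
    (Corr σ l j a b γ' δ ↔ IsConjF σ γ γ')

/-- «if `γ ∈ G(F)` and `X^γ` is non-empty, then there exists `δ ∈ G(E)` such that `γ ↔ δ`» (p. 242; uses (c): «replacing `γ` by a conjugate,
we may assume that `γ ∈ K`. Then our assumption (c) on `K_L` implies that (A′) can be solved»).  `X^γ ≠ ∅` through representatives: some
`gK_L` with `g⁻¹σ(g) ∈ K_L` (it lies in `X`) and `g⁻¹γg ∈ K_L` (it is fixed by `γ`).  Nothing is asserted.
[cite: Kottwitz1986BaseChangeUnits, §1 (p. 242)] -/
def exists_delta_of_fixedCoset (σ : MulAut GL) (l j : ℕ) (a b : ℤ) (KL : Subgroup GL) : Prop :=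
  b * l - a * j = 1 → KLCondA σ KL → KLCondB σ KL → KLCondC σ l KL →
    ∀ γ : GL, IsRatF σ γ → (∃ g : GL, g⁻¹ * σ g ∈ KL ∧ g⁻¹ * γ * g ∈ KL) →
      ∃ δ : GL, IsRatE σ l δ ∧ Corr σ l j a b γ δ

/-- «if `δ ∈ G(E)` and `X_E^{δθ}` is non-empty, then there exists `γ ∈ G(F)` such that `γ ↔ δ`» (p. 242; uses (b)).  `X_E^{δθ} ≠ ∅` through
representatives: some `gK_L` with `g⁻¹σ^l(g) ∈ K_L` (it lies in `X_E`) and `g⁻¹δσ^j(g) ∈ K_L` («`g⁻¹δθ(g) ∈ K_E` if and only if `δθx = x`»,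
p. 240).  Nothing is asserted. [cite: Kottwitz1986BaseChangeUnits, §1 (p. 242)] -/
def exists_gamma_of_fixedCoset (σ : MulAut GL) (l j : ℕ) (a b : ℤ) (KL : Subgroup GL) : Prop :=
  b * l - a * j = 1 → KLCondA σ KL → KLCondB σ KL → KLCondC σ l KL →
    ∀ δ : GL, IsRatE σ l δ → (∃ g : GL, g⁻¹ * (σ ^ l) g ∈ KL ∧ g⁻¹ * δ * (σ ^ j) g ∈ KL) →
      ∃ γ : GL, IsRatF σ γ ∧ Corr σ l j a b γ δ

/-- «Taking `Y = G(L)` with `G(L)` acting by conjugation, we see that `g ↦ cgc⁻¹` induces an isomorphism from `G_γ(F)` to `I_{δθ}(F)`»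
(p. 241), for `γ, δ, c` with (A), (B): conjugation by `c` carries `G_γ(F) = {g ∈ G(F) : gγ = γg}` onto the `θ`-centralizer
`I_{δθ}(F) = {g ∈ G(E) : g⁻¹δθ(g) = δ}`.  Provable as stated; nothing is asserted. [cite: Kottwitz1986BaseChangeUnits, §1 (p. 241)] -/
def centralizer_transport (σ : MulAut GL) (l j : ℕ) (a b : ℤ) : Prop :=
  b * l - a * j = 1 → ∀ γ δ c : GL, IsRatF σ γ → IsRatE σ l δ → CondAB σ l j a b γ δ c →
    ∀ g : GL, (IsRatF σ g ∧ g * γ = γ * g) ↔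
      (IsRatE σ l (c * g * c⁻¹) ∧ (c * g * c⁻¹)⁻¹ * δ * (σ ^ j) (c * g * c⁻¹) = δ)

/-- «Taking `Y = X_L`, we see that `x ↦ cx` induces a bijection from `X^γ` to `X_E^{δθ}`» (p. 241), for `γ, δ, c` with (A), (B) and `K_L`
with (a): through representatives, `gK_L ∈ X^γ` iff `cgK_L ∈ X_E^{δθ}`.  Provable as stated; nothing is asserted.
[cite: Kottwitz1986BaseChangeUnits, §1 (p. 241)] -/
def fixedCoset_transport (σ : MulAut GL) (l j : ℕ) (a b : ℤ) (KL : Subgroup GL) : Prop :=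
  b * l - a * j = 1 → KLCondA σ KL → ∀ γ δ c : GL, IsRatF σ γ → IsRatE σ l δ → CondAB σ l j a b γ δ c →
    ∀ g : GL, (g⁻¹ * σ g ∈ KL ∧ g⁻¹ * γ * g ∈ KL) ↔
      ((c * g)⁻¹ * (σ ^ l) (c * g) ∈ KL ∧ (c * g)⁻¹ * δ * (σ ^ j) (c * g) ∈ KL)

end GroupTheory

/-! ## The orbital integrals (pp. 240, 243–244) — typed skeleton -/

/-- **Carriers for the orbital-integral layer of §1**, over the group-theoretic data above (`GL = G(L)`, `σ`, `l`, `j`, `a`, `b`, `K_L`):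
Haar measures on `G(F)`, `G(E)` giving `K`, `K_E` measure `1`; `f`, `f_E` the characteristic functions of `K`, `K_E` (p. 240).  Fields:
* `orbF γ = O_γ(f)` (`γ ∈ G(F)`), `orbE δ = O_{δθ}(f_E)` (`δ ∈ G(E)`), `stOrbF γ = SO_γ(f)`, `stOrbE δ = SO_{δθ}(f_E)` (stable integrals, p. 238–239);
* `RepsF γ` — «a set of representatives for the orbits of `G_γ(F)` on `X^γ`», `measStabF γ x = meas(G_γ(F)_x)`; `RepsE δ` — representatives for
  the orbits of `I_{δθ}(F)` on `X_E^{δθ}`, `measStabE δ x = meas(I_{δθ}(F)_x)` (p. 240–241);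
* `IsSemisimple γ`; `IsStableNormOf γ δ` — «the stable conjugacy class of `γ` is equal to `𝒩δ`» (p. 239);
* `eF γ = e(G_γ)`, `eE δ = e(I_{δθ})` — Kottwitz signs [Kottwitz1983] (p. 243).
Parallel posit of the Introduction's carriers (TK-t12, `UnitBaseChange.lean`); consolidation by import in a later edition.
[cite: Kottwitz1986BaseChangeUnits, §1 (pp. 240, 243–244)] -/
structure OrbitalDatum (GL : Type u) [Group GL] where
  /-- `O_γ(f)` -/
  orbF : GL → ℝ
  /-- `O_{δθ}(f_E)` -/
  orbE : GL → ℝ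
  /-- `SO_γ(f)` -/
  stOrbF : GL → ℝ
  /-- `SO_{δθ}(f_E)` -/
  stOrbE : GL → ℝ
  /-- representatives of the `G_γ(F)`-orbits on `X^γ` -/
  RepsF : GL → Type v
  /-- `meas(G_γ(F)_x)` -/
  measStabF : (γ : GL) → RepsF γ → ℝ
  /-- representatives of the `I_{δθ}(F)`-orbits on `X_E^{δθ}` -/
  RepsE : GL → Type v
  /-- `meas(I_{δθ}(F)_x)` -/
  measStabE : (δ : GL) → RepsE δ → ℝ
  /-- `γ` is semisimple -/
  IsSemisimple : GL → Prop
  /-- the stable conjugacy class of `γ` equals `𝒩δ` -/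
  IsStableNormOf : GL → GL → Prop
  /-- `e(G_γ)` -/
  eF : GL → ℤˣ
  /-- `e(I_{δθ})` -/
  eE : GL → ℤˣ

namespace OrbitalDatum

variable {GL : Type u} [Group GL]

/-- **p. 240**: «`O_{δθ}(f_E) = Σ_x meas(I_{δθ}(F)_x)⁻¹`, where `x` runs through a set of representatives for the orbits of `I_{δθ}(F)` on `X_E^{δθ}`»
(`δ ∈ G(E)`).  Nothing is asserted. [cite: Kottwitz1986BaseChangeUnits, §1 (p. 240)] -/
def Eq240E (D : OrbitalDatum.{u, v} GL) (σ : MulAut GL) (l : ℕ) : Prop :=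
  ∀ δ : GL, IsRatE σ l δ → D.orbE δ = ∑ᶠ x : D.RepsE δ, (D.measStabE δ x)⁻¹

/-- **p. 240–241**: «`O_γ(f) = Σ_x meas(G_γ(F)_x)⁻¹`, where `x` runs through a set of representatives for the orbits of `G_γ(F)` on `X^γ`»
(`γ ∈ G(F)`).  Nothing is asserted. [cite: Kottwitz1986BaseChangeUnits, §1 (pp. 240–241)] -/
def Eq240F (D : OrbitalDatum.{u, v} GL) (σ : MulAut GL) : Prop :=
  ∀ γ : GL, IsRatF σ γ → D.orbF γ = ∑ᶠ x : D.RepsF γ, (D.measStabF γ x)⁻¹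

/-- «`O_γ(f) ≠ 0` (resp. `O_{δθ}(f_E) ≠ 0`) if and only if `X^γ` (resp. `X_E^{δθ}`) is non-empty» (p. 243), the fixed cosets through
representatives as in `exists_delta_of_fixedCoset` ∕ `exists_gamma_of_fixedCoset`.  Nothing is asserted.
[cite: Kottwitz1986BaseChangeUnits, §1 (p. 243)] -/
def orb_ne_zero_iff (D : OrbitalDatum.{u, v} GL) (σ : MulAut GL) (l j : ℕ) (KL : Subgroup GL) : Prop :=
  (∀ γ : GL, IsRatF σ γ → (D.orbF γ ≠ 0 ↔ ∃ g : GL, g⁻¹ * σ g ∈ KL ∧ g⁻¹ * γ * g ∈ KL)) ∧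
    ∀ δ : GL, IsRatE σ l δ → (D.orbE δ ≠ 0 ↔ ∃ g : GL, g⁻¹ * (σ ^ l) g ∈ KL ∧ g⁻¹ * δ * (σ ^ j) g ∈ KL)

/-- **[Kottwitz1986BaseChangeUnits, THEOREM, p. 243]**, AS PRINTED: «The correspondence `γ ↔ δ` induces a bijection from the set of conjugacy
classes of `γ ∈ G(F)` such that `O_γ(f) ≠ 0` to the set of `θ`-conjugacy classes of `δ ∈ G(E)` such that `O_{δθ}(f_E) ≠ 0`. Moreover if
`γ ↔ δ`, then `γ = 𝒩δ`, `G_γ(F)` is isomorphic to `I_{δθ}(F)`, and `O_γ(f) = O_{δθ}(f_E)`.»  TYPED: (i) every `γ ∈ G(F)` with `O_γ(f) ≠ 0`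
corresponds to some `δ ∈ G(E)` with `O_{δθ}(f_E) ≠ 0` and conversely; (ii) two corresponding pairs have conjugate `γ`'s iff they have
`θ`-conjugate `δ`'s, and `↔` is stable under conjugacy on both sides (so `↔` descends to a bijection of classes); (iii) for `γ ↔ δ`: `𝒩δ = γ` (the stable class of
`γ` is `𝒩δ`), and `O_γ(f) = O_{δθ}(f_E)` (the isomorphism `G_γ(F) ≅ I_{δθ}(F)` is `centralizer_transport`).  Nothing is asserted.
[cite: Kottwitz1986BaseChangeUnits, Theorem (p. 243)] -/
def Theorem (D : OrbitalDatum.{u, v} GL) (σ : MulAut GL) (l j : ℕ) (a b : ℤ) : Prop :=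
  b * l - a * j = 1 →
    (∀ γ : GL, IsRatF σ γ → D.orbF γ ≠ 0 → ∃ δ : GL, IsRatE σ l δ ∧ D.orbE δ ≠ 0 ∧ Corr σ l j a b γ δ) ∧
    (∀ δ : GL, IsRatE σ l δ → D.orbE δ ≠ 0 → ∃ γ : GL, IsRatF σ γ ∧ D.orbF γ ≠ 0 ∧ Corr σ l j a b γ δ) ∧
    (∀ γ γ' δ δ' : GL, IsRatF σ γ → IsRatF σ γ' → IsRatE σ l δ → IsRatE σ l δ' →
      Corr σ l j a b γ δ → Corr σ l j a b γ' δ' → (IsConjF σ γ γ' ↔ IsThetaConj σ l j δ δ')) ∧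
    (∀ γ γ' δ δ' : GL, IsRatF σ γ → IsRatF σ γ' → IsRatE σ l δ → IsRatE σ l δ' →
      Corr σ l j a b γ δ → IsConjF σ γ γ' → IsThetaConj σ l j δ δ' → Corr σ l j a b γ' δ') ∧
    ∀ γ δ : GL, IsRatF σ γ → IsRatE σ l δ → Corr σ l j a b γ δ →
      D.IsStableNormOf γ δ ∧ D.orbF γ = D.orbE δ

/-- «It will also show that the signs `e(G_γ)` and `e(I_{δθ})` are equal» (p. 243, `γ` semisimple, `γ ↔ δ`).  Nothing is asserted.
[cite: Kottwitz1986BaseChangeUnits, §1 (p. 243)] -/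
def signs_equal (D : OrbitalDatum.{u, v} GL) (σ : MulAut GL) (l j : ℕ) (a b : ℤ) : Prop :=
  ∀ γ δ : GL, IsRatF σ γ → IsRatE σ l δ → D.IsSemisimple γ → Corr σ l j a b γ δ → D.eF γ = D.eE δ

/-- **[Kottwitz1986BaseChangeUnits, COROLLARY, p. 244]**, AS PRINTED: «The functions `f`, `f_E` have matching orbital integrals», i.e. (p. 239) «for
every semisimple `γ ∈ G(F)` the stable orbital integral `SO_γ(f)` vanishes unless the stable conjugacy class of `γ` is equal to `𝒩δ` for some
`δ ∈ G(E)`, in which case it is given by `SO_γ(f) = SO_{δθ}(f_E)`».  Nothing is asserted. [cite: Kottwitz1986BaseChangeUnits, Corollary (p. 244)] -/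
def Corollary (D : OrbitalDatum.{u, v} GL) (σ : MulAut GL) (l : ℕ) : Prop :=
  ∀ γ : GL, IsRatF σ γ → D.IsSemisimple γ →
    (D.stOrbF γ ≠ 0 → ∃ δ : GL, IsRatE σ l δ ∧ D.IsStableNormOf γ δ) ∧
      ∀ δ : GL, IsRatE σ l δ → D.IsStableNormOf γ δ → D.stOrbF γ = D.stOrbE δ

/-- **The supplement to the Corollary** (p. 244), AS PRINTED: «if `𝒩δ` does not exist in `G(F)`, then `SO_{δθ}(f_E) = 0`» (`δ ∈ G(E)`; «if `G` is
not quasi-split, the stable conjugacy class of `Nδ` need not contain any `F`-rational elements»).  Nothing is asserted.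
[cite: Kottwitz1986BaseChangeUnits, §1 (p. 244)] -/
def Supplement (D : OrbitalDatum.{u, v} GL) (σ : MulAut GL) (l : ℕ) : Prop :=
  ∀ δ : GL, IsRatE σ l δ → (¬ ∃ γ : GL, IsRatF σ γ ∧ D.IsStableNormOf γ δ) → D.stOrbE δ = 0

end OrbitalDatum


/-! ## Edition 2 (proof lane): the group theory of §1 discharged

Everything below is PROVED (no new predicate is introduced; the one new definition, `liftSubgroup` = `K_L ⋊ ⟨σ⟩ ≤ G(L) ⋊ ⟨σ⟩`, has a body).
The architecture follows the print (p. 241: «let `x ∈ Y`. Then `x` is fixed by `⟨γ, σ⟩` if and only if it is fixed by `γ^aσ^l`, `γ^bσ^j`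
(use that `bl − aj = 1`) […]»): for commuting `x, y` in any group and `bl − aj = 1` one has `x = (x^a y^l)^{−j}(x^b y^j)^{l}` and
`y = (x^a y^l)^{b}(x^b y^j)^{−a}` (`pair_gen_fst`, `pair_gen_snd`), so centralizing / normalizing / conjugating the pair `(γ^aσ^l, γ^bσ^j)` is the
same as for `(γ, σ)`; (A), (B) say that `Int(c)` carries that pair to `(σ^l, δσ^j)` (`condAB_iff_conj`).  The component computations in
`G(L) ⋊ ⟨σ⟩` (`frobPow_mul_inl`, `conj_inl_inlF`, …) are Mathlib's `SemidirectProduct.mul_left` etc. -/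

section PairGeneration

variable {M : Type u} [Group M]

/-- For commuting `x, y`, the elements `x^a y^l` and `x^b y^j` commute. [cite: Kottwitz1986BaseChangeUnits, §1 (p. 241)] -/
theorem pair_commute (x y : M) (h : Commute x y) (a l b j : ℤ) :
    Commute (x ^ a * y ^ l) (x ^ b * y ^ j) :=
  (((Commute.refl x).zpow_zpow a b).mul_right (h.zpow_zpow a j)).mul_left
    (((h.zpow_zpow b l).symm).mul_right ((Commute.refl y).zpow_zpow l j))

/-- For commuting `x, y` and `bl − aj = 1`: `x = (x^a y^l)^{−j} (x^b y^j)^{l}`. [cite: Kottwitz1986BaseChangeUnits, §1 (p. 241)] -/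
theorem pair_gen_fst (x y : M) (h : Commute x y) (a l b j : ℤ) (hd : b * l - a * j = 1) :
    (x ^ a * y ^ l) ^ (-j) * (x ^ b * y ^ j) ^ l = x := by
  rw [(h.zpow_zpow a l).mul_zpow, (h.zpow_zpow b j).mul_zpow, ← zpow_mul, ← zpow_mul, ← zpow_mul,
    ← zpow_mul]
  calc x ^ (a * -j) * y ^ (l * -j) * (x ^ (b * l) * y ^ (j * l))
      = x ^ (a * -j) * (y ^ (l * -j) * x ^ (b * l)) * y ^ (j * l) := by simp only [mul_assoc]
    _ = x ^ (a * -j) * (x ^ (b * l) * y ^ (l * -j)) * y ^ (j * l) := by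
        rw [← (h.zpow_zpow (b * l) (l * -j)).eq]
    _ = x ^ (a * -j + b * l) * y ^ (l * -j + j * l) := by rw [zpow_add, zpow_add]; simp only [mul_assoc]
    _ = x := by
        rw [show a * -j + b * l = 1 by linear_combination hd, show l * -j + j * l = 0 by ring]
        simp

/-- For commuting `x, y` and `bl − aj = 1`: `y = (x^a y^l)^{b} (x^b y^j)^{−a}`. [cite: Kottwitz1986BaseChangeUnits, §1 (p. 241)] -/
theorem pair_gen_snd (x y : M) (h : Commute x y) (a l b j : ℤ) (hd : b * l - a * j = 1) :
    (x ^ a * y ^ l) ^ b * (x ^ b * y ^ j) ^ (-a) = y := by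
  rw [(h.zpow_zpow a l).mul_zpow, (h.zpow_zpow b j).mul_zpow, ← zpow_mul, ← zpow_mul, ← zpow_mul,
    ← zpow_mul]
  calc x ^ (a * b) * y ^ (l * b) * (x ^ (b * -a) * y ^ (j * -a))
      = x ^ (a * b) * (y ^ (l * b) * x ^ (b * -a)) * y ^ (j * -a) := by simp only [mul_assoc]
    _ = x ^ (a * b) * (x ^ (b * -a) * y ^ (l * b)) * y ^ (j * -a) := by
        rw [← (h.zpow_zpow (b * -a) (l * b)).eq]
    _ = x ^ (a * b + b * -a) * y ^ (l * b + j * -a) := by rw [zpow_add, zpow_add]; simp only [mul_assoc]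
    _ = y := by
        rw [show a * b + b * -a = 0 by ring, show l * b + j * -a = 1 by linear_combination hd]
        simp

/-- `z` commutes with `x` and `y` iff it commutes with `x^a y^l` and `x^b y^j` (`bl − aj = 1`). [cite: Kottwitz1986BaseChangeUnits, §1 (p. 241)] -/
theorem commute_pair_iff (z x y : M) (h : Commute x y) (a l b j : ℤ) (hd : b * l - a * j = 1) :
    (Commute z y ∧ Commute z x) ↔ (Commute z (x ^ a * y ^ l) ∧ Commute z (x ^ b * y ^ j)) := by
  constructor
  · rintro ⟨hy, hx⟩
    exact ⟨(hx.zpow_right a).mul_right (hy.zpow_right l), (hx.zpow_right b).mul_right (hy.zpow_right j)⟩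
  · rintro ⟨hP, hQ⟩
    refine ⟨?_, ?_⟩
    · have := (hP.zpow_right b).mul_right (hQ.zpow_right (-a))
      rwa [pair_gen_snd x y h a l b j hd] at this
    · have := (hP.zpow_right (-j)).mul_right (hQ.zpow_right l)
      rwa [pair_gen_fst x y h a l b j hd] at this

/-- Subgroup version, through an automorphism `T`: `T y, T x ∈ S` iff `T (x^a y^l), T (x^b y^j) ∈ S`. [cite: Kottwitz1986BaseChangeUnits, §1 (p. 241)] -/
theorem map_mem_pair_iff (S : Subgroup M) (T : MulAut M) (x y : M) (h : Commute x y) (a l b j : ℤ)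
    (hd : b * l - a * j = 1) :
    (T y ∈ S ∧ T x ∈ S) ↔ (T (x ^ a * y ^ l) ∈ S ∧ T (x ^ b * y ^ j) ∈ S) := by
  constructor
  · rintro ⟨hy, hx⟩
    rw [map_mul, map_zpow, map_zpow, map_mul, map_zpow, map_zpow]
    exact ⟨S.mul_mem (S.zpow_mem hx a) (S.zpow_mem hy l), S.mul_mem (S.zpow_mem hx b) (S.zpow_mem hy j)⟩
  · rintro ⟨hP, hQ⟩
    refine ⟨?_, ?_⟩
    · have := S.mul_mem (S.zpow_mem hP b) (S.zpow_mem hQ (-a))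
      rwa [← map_zpow, ← map_zpow, ← map_mul, pair_gen_snd x y h a l b j hd] at this
    · have := S.mul_mem (S.zpow_mem hP (-j)) (S.zpow_mem hQ l)
      rwa [← map_zpow, ← map_zpow, ← map_mul, pair_gen_fst x y h a l b j hd] at this

/-- If an automorphism `T` carries `x^a y^l ↦ x'^a y'^l` and `x^b y^j ↦ x'^b y'^j` (`bl − aj = 1`, both pairs
commuting), then `T x = x'` and `T y = y'`. [cite: Kottwitz1986BaseChangeUnits, §1 (p. 241)] -/
theorem map_gen_of_map_pair (T : MulAut M) (x y x' y' : M) (h : Commute x y) (h' : Commute x' y')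
    (a l b j : ℤ) (hd : b * l - a * j = 1) (hP : T (x ^ a * y ^ l) = x' ^ a * y' ^ l)
    (hQ : T (x ^ b * y ^ j) = x' ^ b * y' ^ j) : T x = x' ∧ T y = y' := by
  constructor
  · rw [← pair_gen_fst x y h a l b j hd, map_mul, map_zpow, map_zpow, hP, hQ,
      pair_gen_fst x' y' h' a l b j hd]
  · rw [← pair_gen_snd x y h a l b j hd, map_mul, map_zpow, map_zpow, hP, hQ,
      pair_gen_snd x' y' h' a l b j hd]

/-- Conjugation by a fixed element preserves and reflects commutation. [cite: Kottwitz1986BaseChangeUnits, §1 (p. 241)] -/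
theorem commute_conj_iff (C u v : M) : Commute (MulAut.conj C u) (MulAut.conj C v) ↔ Commute u v := by
  simp only [commute_iff_eq, ← map_mul, EmbeddingLike.apply_eq_iff_eq]

end PairGeneration

section Discharges

variable {GL : Type u} [Group GL]

/-- `⟨σ⟩` acts through `n ↦ σ^n` (semidirect-product plumbing for the §1 discharges). [cite: Kottwitz1986BaseChangeUnits, §1 (p. 241)] -/
theorem frobHom_apply (σ : MulAut GL) (g : Multiplicative ℤ) : frobHom σ g = σ ^ g.toAdd := by
  simp [frobHom]

/-- `⟨σ⟩` acts through `n ↦ σ^n` (plumbing). [cite: Kottwitz1986BaseChangeUnits, §1 (p. 241)] -/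
theorem frobHom_ofAdd (σ : MulAut GL) (n : ℤ) : frobHom σ (Multiplicative.ofAdd n) = σ ^ n := by
  simp [frobHom]

/-- `σ^n` as an element of `G(L) ⋊ ⟨σ⟩` (plumbing). [cite: Kottwitz1986BaseChangeUnits, §1 (p. 241)] -/
theorem frobElt_pow (σ : MulAut GL) (n : ℕ) : frobElt σ ^ n = inr (Multiplicative.ofAdd (n : ℤ)) := by
  rw [frobElt, ← map_pow, ← ofAdd_nsmul, nsmul_one]

/-- Powers in `G(L) ⊂ G(L) ⋊ ⟨σ⟩` (plumbing). [cite: Kottwitz1986BaseChangeUnits, §1 (p. 241)] -/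
theorem inl_zpow' (σ : MulAut GL) (x : GL) (n : ℤ) : (inl x : SD σ) ^ n = inl (x ^ n) :=
  (map_zpow _ x n).symm

/-- `G(L)`-component of `xσ^n` (plumbing). [cite: Kottwitz1986BaseChangeUnits, §1 (p. 241)] -/
theorem inlF_left (σ : MulAut GL) (x : GL) (n : ℕ) : (inl x * frobElt σ ^ n : SD σ).left = x := by
  rw [frobElt_pow]; simp

/-- `⟨σ⟩`-component of `xσ^n` (plumbing). [cite: Kottwitz1986BaseChangeUnits, §1 (p. 241)] -/
theorem inlF_right (σ : MulAut GL) (x : GL) (n : ℕ) :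
    (inl x * frobElt σ ^ n : SD σ).right = Multiplicative.ofAdd (n : ℤ) := by
  rw [frobElt_pow]; simp

/-- `⟨σ⟩`-component of a power (plumbing). [cite: Kottwitz1986BaseChangeUnits, §1 (p. 241)] -/
theorem right_zpow (σ : MulAut GL) (z : SD σ) (n : ℤ) : (z ^ n).right = z.right ^ n :=
  map_zpow (rightHom : SD σ →* Multiplicative ℤ) z n

/-- Conjugation by `G(L)` does not change the `⟨σ⟩`-component (plumbing). [cite: Kottwitz1986BaseChangeUnits, §1 (p. 241)] -/
theorem right_conj_inl (σ : MulAut GL) (c : GL) (z : SD σ) : (MulAut.conj (inl c) z).right = z.right := by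
  simp [MulAut.conj_apply]

/-- An element with trivial `⟨σ⟩`-component lies in `G(L)` (plumbing). [cite: Kottwitz1986BaseChangeUnits, §1 (p. 241)] -/
theorem eq_inl_of_right_eq_one (σ : MulAut GL) (z : SD σ) (h : z.right = 1) : z = inl z.left := by
  ext <;> simp [h]

/-- `σ^n · y = σ^n(y) · σ^n` in `G(L) ⋊ ⟨σ⟩`. [cite: Kottwitz1986BaseChangeUnits, §1 (p. 241)] -/
theorem frobPow_mul_inl (σ : MulAut GL) (n : ℕ) (y : GL) :
    frobElt σ ^ n * inl y = (inl ((σ ^ n) y) * frobElt σ ^ n : SD σ) := by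
  rw [frobElt_pow]; ext <;> simp [frobHom_ofAdd]

/-- Product of `xσ^m` and `yσ^n` (plumbing). [cite: Kottwitz1986BaseChangeUnits, §1 (p. 241)] -/
theorem inlF_mul_inlF (σ : MulAut GL) (x y : GL) (m n : ℕ) :
    (inl x * frobElt σ ^ m) * (inl y * frobElt σ ^ n) = (inl (x * (σ ^ m) y) * frobElt σ ^ (m + n) : SD σ) := by
  calc (inl x * frobElt σ ^ m) * (inl y * frobElt σ ^ n)
      = inl x * (frobElt σ ^ m * inl y) * frobElt σ ^ n := by simp only [mul_assoc]
    _ = (inl (x * (σ ^ m) y) * frobElt σ ^ (m + n) : SD σ) := by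
        rw [frobPow_mul_inl, map_mul, pow_add]; simp only [mul_assoc]

/-- `xσ^n = yσ^n ↔ x = y` (plumbing). [cite: Kottwitz1986BaseChangeUnits, §1 (p. 241)] -/
theorem inlF_inj (σ : MulAut GL) (x y : GL) (n : ℕ) :
    (inl x * frobElt σ ^ n : SD σ) = inl y * frobElt σ ^ n ↔ x = y := by
  rw [mul_left_inj, inl_inj]

/-- `xσ^n = σ^n ↔ x = 1` (plumbing). [cite: Kottwitz1986BaseChangeUnits, §1 (p. 241)] -/
theorem inlF_eq_F_iff (σ : MulAut GL) (x : GL) (n : ℕ) :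
    (inl x * frobElt σ ^ n : SD σ) = frobElt σ ^ n ↔ x = 1 := by
  rw [mul_eq_right, map_eq_one_iff _ inl_injective]

/-- `g` commutes with `σ^n` iff `σ^n(g) = g` («`G(E)` = fixed points of `σ^l`», p. 239). [cite: Kottwitz1986BaseChangeUnits, §1 (pp. 239, 241)] -/
theorem commute_inl_frobPow_iff (σ : MulAut GL) (n : ℕ) (y : GL) :
    Commute (inl y : SD σ) (frobElt σ ^ n) ↔ (σ ^ n) y = y := by
  rw [commute_iff_eq, frobPow_mul_inl, inlF_inj, eq_comm]

/-- `g` commutes with `σ` iff `g ∈ G(F)` (p. 239). [cite: Kottwitz1986BaseChangeUnits, §1 (pp. 239, 241)] -/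
theorem commute_inl_frob_iff (σ : MulAut GL) (y : GL) :
    Commute (inl y : SD σ) (frobElt σ) ↔ σ y = y := by
  rw [← pow_one (frobElt σ), commute_inl_frobPow_iff, pow_one]

/-- Commutation inside `G(L)` (plumbing). [cite: Kottwitz1986BaseChangeUnits, §1 (p. 241)] -/
theorem commute_inl_inl_iff (σ : MulAut GL) (x y : GL) :
    Commute (inl x : SD σ) (inl y) ↔ x * y = y * x := by
  rw [commute_iff_eq, ← map_mul, ← map_mul, inl_inj]

/-- `g` commutes with `δσ^n` iff `gδ = δσ^n(g)` (the `θ`-centralizer `I_{δθ}`, p. 241). [cite: Kottwitz1986BaseChangeUnits, §1 (p. 241)] -/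
theorem commute_inl_inlF_iff (σ : MulAut GL) (n : ℕ) (y δ : GL) :
    Commute (inl y : SD σ) (inl δ * frobElt σ ^ n) ↔ y * δ = δ * (σ ^ n) y := by
  rw [commute_iff_eq, ← mul_assoc, ← map_mul, mul_assoc, frobPow_mul_inl, ← mul_assoc, ← map_mul,
    inlF_inj]

/-- `σ^m` commutes with `δσ^n` iff `σ^m(δ) = δ` («`σ^l`, `δσ^j` commute», p. 242). [cite: Kottwitz1986BaseChangeUnits, §1 (p. 242)] -/
theorem commute_frobPow_inlF_iff (σ : MulAut GL) (m n : ℕ) (δ : GL) :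
    Commute (frobElt σ ^ m) (inl δ * frobElt σ ^ n : SD σ) ↔ (σ ^ m) δ = δ := by
  rw [commute_iff_eq, ← mul_assoc, frobPow_mul_inl]
  constructor
  · intro h
    have := congrArg SemidirectProduct.left h
    simpa [mul_left, inlF_left, inlF_right, frobElt_pow, frobHom_ofAdd] using this
  · intro h
    rw [h]; ext
    · simp [frobElt_pow, frobHom_ofAdd]
    · simp [frobElt_pow, mul_comm]

/-- Conjugating `δσ^n` by `y ∈ G(L)`. [cite: Kottwitz1986BaseChangeUnits, §1 (p. 241)] -/
theorem conj_inl_inlF (σ : MulAut GL) (y δ : GL) (n : ℕ) :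
    MulAut.conj (inl y) (inl δ * frobElt σ ^ n : SD σ) = inl (y * δ * ((σ ^ n) y)⁻¹) * frobElt σ ^ n := by
  rw [MulAut.conj_apply, frobElt_pow]; ext <;> simp [frobHom_ofAdd]

/-- Conjugating `σ^n` by `y ∈ G(L)`: `yσ^n y⁻¹ = yσ^n(y)⁻¹σ^n` (plumbing for (A′)). [cite: Kottwitz1986BaseChangeUnits, §1 (A′) (p. 241)] -/
theorem conj_inl_F (σ : MulAut GL) (y : GL) (n : ℕ) :
    MulAut.conj (inl y) (frobElt σ ^ n : SD σ) = inl (y * ((σ ^ n) y)⁻¹) * frobElt σ ^ n := by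
  rw [MulAut.conj_apply, frobElt_pow]; ext <;> simp [frobHom_ofAdd]

/-- Conjugation inside `G(L)` (plumbing). [cite: Kottwitz1986BaseChangeUnits, §1 (p. 241)] -/
theorem conj_inl_inl (σ : MulAut GL) (y x : GL) :
    MulAut.conj (inl y) (inl x : SD σ) = inl (y * x * y⁻¹) := by
  rw [MulAut.conj_apply, map_mul, map_mul, map_inv]

/-- `cσc⁻¹σ⁻¹ = cσ(c⁻¹)` (plumbing for (D′)). [cite: Kottwitz1986BaseChangeUnits, §1 (D′) (p. 242)] -/
theorem conjF_mul_Finv (σ : MulAut GL) (c : GL) :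
    MulAut.conj (inl c : SD σ) (frobElt σ) * (frobElt σ)⁻¹ = inl (c * σ c⁻¹) := by
  have h := conj_inl_F σ c 1
  rw [pow_one, pow_one] at h
  rw [h, mul_inv_cancel_right, map_inv]

/-- (A), (B) through `MulAut.conj`. [cite: Kottwitz1986BaseChangeUnits, §1 (A), (B) (p. 241)] -/
theorem condAB_iff_conj (σ : MulAut GL) (l j : ℕ) (a b : ℤ) (γ δ c : GL) :
    CondAB σ l j a b γ δ c ↔
      MulAut.conj (inl c) ((inl γ : SD σ) ^ a * frobElt σ ^ (l : ℤ)) = frobElt σ ^ (l : ℤ) ∧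
        MulAut.conj (inl c) ((inl γ : SD σ) ^ b * frobElt σ ^ (j : ℤ)) = inl δ * frobElt σ ^ (j : ℤ) := by
  simp only [CondAB, MulAut.conj_apply, zpow_natCast, mul_assoc]

/-- `y⁻¹δs = δ ↔ yδ = δs` (plumbing for `I_{δθ}`). [cite: Kottwitz1986BaseChangeUnits, §1 (p. 241)] -/
theorem inv_mul_mul_eq_iff (y δ s : GL) : y⁻¹ * δ * s = δ ↔ y * δ = δ * s := by
  rw [mul_assoc, inv_mul_eq_iff_eq_mul, eq_comm]

/-! ### `K_L ⋊ ⟨σ⟩` -/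

/-- (a) `σ(K_L) = K_L`: `σ` maps `K_L` into itself. [cite: Kottwitz1986BaseChangeUnits, §1 (a) (p. 240)] -/
theorem map_mem_of_KLCondA (σ : MulAut GL) (KL : Subgroup GL) (hA : KLCondA σ KL) (k : GL)
    (hk : k ∈ KL) : σ k ∈ KL := by
  have : σ k ∈ KL.map σ.toMonoidHom := Subgroup.mem_map_of_mem _ hk
  rwa [hA] at this

/-- (a) `σ(K_L) = K_L`: `σ⁻¹` maps `K_L` into itself. [cite: Kottwitz1986BaseChangeUnits, §1 (a) (p. 240)] -/
theorem inv_map_mem_of_KLCondA (σ : MulAut GL) (KL : Subgroup GL) (hA : KLCondA σ KL) (k : GL)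
    (hk : k ∈ KL) : σ⁻¹ k ∈ KL := by
  have hk' : k ∈ KL.map σ.toMonoidHom := by rw [hA]; exact hk
  obtain ⟨k', hk', rfl⟩ := Subgroup.mem_map.1 hk'
  simpa using hk'

/-- A `K_L`-stable automorphism has `K_L`-stable powers (plumbing for (a)). [cite: Kottwitz1986BaseChangeUnits, §1 (a) (p. 240)] -/
theorem pow_map_mem (τ : MulAut GL) (KL : Subgroup GL) (hτ : ∀ k ∈ KL, τ k ∈ KL) (n : ℕ) (k : GL)
    (hk : k ∈ KL) : (τ ^ n) k ∈ KL := by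
  induction n generalizing k with
  | zero => simpa using hk
  | succ n ih => rw [pow_succ, MulAut.mul_apply]; exact ih _ (hτ k hk)

/-- (a) `σ(K_L) = K_L`: every `σ^n`, `n ∈ ℤ`, maps `K_L` into itself. [cite: Kottwitz1986BaseChangeUnits, §1 (a) (p. 240)] -/
theorem zpow_map_mem_of_KLCondA (σ : MulAut GL) (KL : Subgroup GL) (hA : KLCondA σ KL) (n : ℤ)
    (k : GL) (hk : k ∈ KL) : (σ ^ n) k ∈ KL := by
  cases n with
  | ofNat n =>
      rw [Int.ofNat_eq_natCast, zpow_natCast]; exact pow_map_mem σ KL (map_mem_of_KLCondA σ KL hA) n k hk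
  | negSucc n =>
      rw [zpow_negSucc, ← inv_pow]
      exact pow_map_mem σ⁻¹ KL (inv_map_mem_of_KLCondA σ KL hA) (n + 1) k hk

/-- The subgroup `K_L ⋊ ⟨σ⟩` of `G(L) ⋊ ⟨σ⟩` (for `K_L` with (a) `σ(K_L) = K_L`, p. 240): the elements whose
`G(L)`-component lies in `K_L`. [cite: Kottwitz1986BaseChangeUnits, §1 (p. 240)] -/
def liftSubgroup (σ : MulAut GL) (KL : Subgroup GL) (hA : KLCondA σ KL) : Subgroup (SD σ) where
  carrier := {z | z.left ∈ KL}
  mul_mem' := by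
    intro z w hz hw
    simp only [Set.mem_setOf_eq, mul_left, frobHom_apply] at *
    exact KL.mul_mem hz (zpow_map_mem_of_KLCondA σ KL hA _ _ hw)
  one_mem' := by simp
  inv_mem' := by
    intro z hz
    simp only [Set.mem_setOf_eq, inv_left, frobHom_apply] at *
    exact zpow_map_mem_of_KLCondA σ KL hA _ _ (KL.inv_mem hz)

/-- Membership in `K_L ⋊ ⟨σ⟩` (plumbing). [cite: Kottwitz1986BaseChangeUnits, §1 (p. 240)] -/
theorem mem_liftSubgroup_iff (σ : MulAut GL) (KL : Subgroup GL) (hA : KLCondA σ KL) (z : SD σ) :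
    z ∈ liftSubgroup σ KL hA ↔ z.left ∈ KL := Iff.rfl

/-- `G(L) ∩ (K_L ⋊ ⟨σ⟩) = K_L` (plumbing). [cite: Kottwitz1986BaseChangeUnits, §1 (p. 240)] -/
theorem inl_mem_liftSubgroup_iff (σ : MulAut GL) (KL : Subgroup GL) (hA : KLCondA σ KL) (x : GL) :
    (inl x : SD σ) ∈ liftSubgroup σ KL hA ↔ x ∈ KL := by
  rw [mem_liftSubgroup_iff, left_inl]

/-- `xσ^n ∈ K_L ⋊ ⟨σ⟩ ↔ x ∈ K_L` (plumbing). [cite: Kottwitz1986BaseChangeUnits, §1 (p. 240)] -/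
theorem inlF_mem_liftSubgroup_iff (σ : MulAut GL) (KL : Subgroup GL) (hA : KLCondA σ KL) (x : GL) (n : ℕ) :
    (inl x * frobElt σ ^ n : SD σ) ∈ liftSubgroup σ KL hA ↔ x ∈ KL := by
  rw [mem_liftSubgroup_iff, inlF_left]

/-- `y⁻¹σ^n y = y⁻¹σ^n(y)σ^n` («`gK_L` is `σ`-fixed iff `g⁻¹σ(g) ∈ K_L`», p. 240). [cite: Kottwitz1986BaseChangeUnits, §1 (p. 240)] -/
theorem conjInv_F (σ : MulAut GL) (y : GL) (n : ℕ) :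
    (MulAut.conj (inl y : SD σ))⁻¹ (frobElt σ ^ n) = inl (y⁻¹ * (σ ^ n) y) * frobElt σ ^ n := by
  rw [← map_inv, ← map_inv, conj_inl_F, map_inv, inv_inv]

/-- `y⁻¹(δσ^n)y = y⁻¹δσ^n(y)σ^n` («`g⁻¹δθ(g) ∈ K_E` iff `δθx = x`», p. 240). [cite: Kottwitz1986BaseChangeUnits, §1 (p. 240)] -/
theorem conjInv_inlF (σ : MulAut GL) (y δ : GL) (n : ℕ) :
    (MulAut.conj (inl y : SD σ))⁻¹ (inl δ * frobElt σ ^ n) = inl (y⁻¹ * δ * (σ ^ n) y) * frobElt σ ^ n := by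
  rw [← map_inv, ← map_inv, conj_inl_inlF, map_inv, inv_inv]

/-- Conjugation inside `G(L)` (plumbing). [cite: Kottwitz1986BaseChangeUnits, §1 (p. 241)] -/
theorem conjInv_inl (σ : MulAut GL) (y x : GL) :
    (MulAut.conj (inl y : SD σ))⁻¹ (inl x) = inl (y⁻¹ * x * y) := by
  rw [MulAut.conj_inv_apply, ← map_inv, ← map_mul, ← map_mul]

/-! ### Discharges -/

/-- PROOF of `corr_iff_primed` ((A), (B) ⟺ (A′), (B′)). [cite: Kottwitz1986BaseChangeUnits, §1 (A′), (B′) (p. 241)] -/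
theorem corr_iff_primed_holds : ∀ (σ : MulAut GL) (l j : ℕ) (a b : ℤ), corr_iff_primed σ l j a b := by
  intro σ l j a b γ δ c
  rw [condAB_iff_conj, zpow_natCast, zpow_natCast, inl_zpow', inl_zpow', conj_inl_inlF, conj_inl_inlF,
    inlF_eq_F_iff, inlF_inj, mul_inv_eq_one]
  constructor
  · rintro ⟨hA, hB⟩
    exact ⟨by rw [← hA]; group, by rw [← hB, map_inv]⟩
  · rintro ⟨hA, hB⟩
    exact ⟨by rw [hA]; group, by rw [hB, map_inv]⟩

/-- PROOF of `norm_eq_conj` ((C′): `Nδ = cγc⁻¹`). [cite: Kottwitz1986BaseChangeUnits, §1 (C′) (p. 242)] -/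
theorem norm_eq_conj_holds : ∀ (σ : MulAut GL) (l j : ℕ) (a b : ℤ), norm_eq_conj σ l j a b := by
  intro σ l j a b hd γ δ c hγ _hδ hAB
  have hcomm : Commute (inl γ : SD σ) (frobElt σ) := (commute_inl_frob_iff σ γ).2 hγ
  obtain ⟨hA, hB⟩ := (condAB_iff_conj σ l j a b γ δ c).1 hAB
  have hx : ((inl γ : SD σ) ^ b * frobElt σ ^ (j : ℤ)) ^ (l : ℤ) *
      (((inl γ : SD σ) ^ a * frobElt σ ^ (l : ℤ)) ^ (j : ℤ))⁻¹ = inl γ := by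
    rw [← zpow_neg, ← ((pair_commute _ _ hcomm a l b j).zpow_zpow _ _).eq]
    exact pair_gen_fst _ _ hcomm a l b j hd
  have e1 : (inl δ * frobElt σ ^ j : SD σ) =
      MulAut.conj (inl c) ((inl γ : SD σ) ^ b * frobElt σ ^ (j : ℤ)) := by rw [hB, zpow_natCast]
  have e2 : (frobElt σ ^ (j * l) : SD σ) =
      MulAut.conj (inl c) (((inl γ : SD σ) ^ a * frobElt σ ^ (l : ℤ)) ^ j) := by
    rw [map_pow, hA, zpow_natCast, pow_mul']
  have key : (inl δ * frobElt σ ^ j) ^ l * (frobElt σ ^ (j * l))⁻¹ = (inl (c * γ * c⁻¹) : SD σ) := by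
    rw [e1, e2, ← map_pow (MulAut.conj (inl c : SD σ)), ← map_inv (MulAut.conj (inl c : SD σ)),
      ← map_mul (MulAut.conj (inl c : SD σ)), ← zpow_natCast, ← zpow_natCast, hx, conj_inl_inl]
  unfold normElt
  rw [key, left_inl]

/-- PROOF of `centralizer_transport` (`G_γ(F) ≅ I_{δθ}(F)` by `g ↦ cgc⁻¹`). [cite: Kottwitz1986BaseChangeUnits, §1 (p. 241)] -/
theorem centralizer_transport_holds :
    ∀ (σ : MulAut GL) (l j : ℕ) (a b : ℤ), centralizer_transport σ l j a b := by
  intro σ l j a b hd γ δ c hγ _hδ hAB g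
  have hcomm : Commute (inl γ : SD σ) (frobElt σ) := (commute_inl_frob_iff σ γ).2 hγ
  obtain ⟨hA, hB⟩ := (condAB_iff_conj σ l j a b γ δ c).1 hAB
  have e1 : (IsRatF σ g ∧ g * γ = γ * g) ↔
      (Commute (inl g : SD σ) (frobElt σ) ∧ Commute (inl g : SD σ) (inl γ)) := by
    rw [commute_inl_frob_iff, commute_inl_inl_iff]; rfl
  have e2 : (IsRatE σ l (c * g * c⁻¹) ∧ (c * g * c⁻¹)⁻¹ * δ * (σ ^ j) (c * g * c⁻¹) = δ) ↔
      (Commute (MulAut.conj (inl c) (inl g : SD σ)) (frobElt σ ^ (l : ℤ)) ∧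
        Commute (MulAut.conj (inl c) (inl g : SD σ)) (inl δ * frobElt σ ^ (j : ℤ))) := by
    rw [conj_inl_inl, zpow_natCast, zpow_natCast, commute_inl_frobPow_iff, commute_inl_inlF_iff,
      inv_mul_mul_eq_iff]; rfl
  rw [e1, e2, ← hA, ← hB, commute_conj_iff, commute_conj_iff]
  exact commute_pair_iff (inl g) (inl γ) (frobElt σ) hcomm a l b j hd

/-- PROOF of `exists_delta_iff` («`δ` exists iff (A′) can be solved»). [cite: Kottwitz1986BaseChangeUnits, §1 (p. 241)] -/
theorem exists_delta_iff_holds : ∀ (σ : MulAut GL) (l j : ℕ) (a b : ℤ), exists_delta_iff σ l j a b := by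
  intro σ l j a b _hd γ hγ
  constructor
  · rintro ⟨δ, _hδ, c, hAB⟩
    exact ⟨c, ((corr_iff_primed_holds σ l j a b γ δ c).1 hAB).1⟩
  · rintro ⟨c, hc⟩
    have hAB : CondAB σ l j a b γ (c * γ ^ b * (σ ^ j) c⁻¹) c :=
      (corr_iff_primed_holds σ l j a b γ _ c).2 ⟨hc, rfl⟩
    refine ⟨c * γ ^ b * (σ ^ j) c⁻¹, ?_, c, hAB⟩
    obtain ⟨hA, hB⟩ := (condAB_iff_conj σ l j a b γ _ c).1 hAB
    have hcomm : Commute (inl γ : SD σ) (frobElt σ) := (commute_inl_frob_iff σ γ).2 hγ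
    have : Commute (frobElt σ ^ (l : ℤ))
        (inl (c * γ ^ b * (σ ^ j) c⁻¹) * frobElt σ ^ (j : ℤ) : SD σ) := by
      rw [← hA, ← hB, commute_conj_iff]; exact pair_commute _ _ hcomm a l b j
    rwa [zpow_natCast, zpow_natCast, commute_frobPow_inlF_iff] at this

/-- PROOF of `corr_delta_unique` (`γ ↔ δ′` iff `δ, δ′` are `θ`-conjugate under `G(E)`). [cite: Kottwitz1986BaseChangeUnits, §1 (p. 241)] -/
theorem corr_delta_unique_holds :
    ∀ (σ : MulAut GL) (l j : ℕ) (a b : ℤ), corr_delta_unique σ l j a b := by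
  intro σ l j a b _hd γ δ δ' _hγ _hδ _hδ' hc
  obtain ⟨c, hAB⟩ := hc
  obtain ⟨hA, hB⟩ := (condAB_iff_conj σ l j a b γ δ c).1 hAB
  constructor
  · rintro ⟨c', hAB'⟩
    obtain ⟨hA', hB'⟩ := (condAB_iff_conj σ l j a b γ δ' c').1 hAB'
    have hP : (MulAut.conj (inl c : SD σ))⁻¹ (frobElt σ ^ (l : ℤ)) =
        (inl γ) ^ a * frobElt σ ^ (l : ℤ) := by
      rw [MulAut.inv_apply, MulEquiv.symm_apply_eq, hA]
    have hQ : (MulAut.conj (inl c : SD σ))⁻¹ (inl δ * frobElt σ ^ (j : ℤ)) =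
        (inl γ) ^ b * frobElt σ ^ (j : ℤ) := by
      rw [MulAut.inv_apply, MulEquiv.symm_apply_eq, hB]
    have hcc : (inl (c' * c⁻¹) : SD σ) = inl c' * (inl c)⁻¹ := by rw [map_mul, map_inv]
    have h1 : MulAut.conj (inl (c' * c⁻¹) : SD σ) (frobElt σ ^ (l : ℤ)) = frobElt σ ^ (l : ℤ) := by
      rw [hcc, map_mul MulAut.conj, map_inv MulAut.conj, MulAut.mul_apply, hP, hA']
    have h2 : MulAut.conj (inl (c' * c⁻¹) : SD σ) (inl δ * frobElt σ ^ (j : ℤ)) =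
        inl δ' * frobElt σ ^ (j : ℤ) := by
      rw [hcc, map_mul MulAut.conj, map_inv MulAut.conj, MulAut.mul_apply, hQ, hB']
    rw [zpow_natCast, conj_inl_F, inlF_eq_F_iff, mul_inv_eq_one] at h1
    rw [zpow_natCast, conj_inl_inlF, inlF_inj] at h2
    exact ⟨c' * c⁻¹, h1.symm, h2.symm⟩
  · rintro ⟨g, hg, hδ'⟩
    have hgc : (inl (g * c) : SD σ) = inl g * inl c := map_mul inl g c
    refine ⟨g * c, (condAB_iff_conj σ l j a b γ δ' _).2 ⟨?_, ?_⟩⟩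
    · rw [hgc, map_mul MulAut.conj, MulAut.mul_apply, hA, zpow_natCast, conj_inl_F, inlF_eq_F_iff,
        mul_inv_eq_one]
      exact hg.symm
    · rw [hgc, map_mul MulAut.conj, MulAut.mul_apply, hB, zpow_natCast, conj_inl_inlF, inlF_inj]
      exact hδ'.symm

/-- PROOF of `corr_gamma_unique` (`γ′ ↔ δ` iff `γ, γ′` conjugate in `G(F)`). [cite: Kottwitz1986BaseChangeUnits, §1 (p. 242)] -/
theorem corr_gamma_unique_holds :
    ∀ (σ : MulAut GL) (l j : ℕ) (a b : ℤ), corr_gamma_unique σ l j a b := by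
  intro σ l j a b hd γ γ' δ hγ hγ' _hδ hc
  obtain ⟨c, hAB⟩ := hc
  have hcomm : Commute (inl γ : SD σ) (frobElt σ) := (commute_inl_frob_iff σ γ).2 hγ
  have hcomm' : Commute (inl γ' : SD σ) (frobElt σ) := (commute_inl_frob_iff σ γ').2 hγ'
  obtain ⟨hA, hB⟩ := (condAB_iff_conj σ l j a b γ δ c).1 hAB
  constructor
  · rintro ⟨c', hAB'⟩
    obtain ⟨hA', hB'⟩ := (condAB_iff_conj σ l j a b γ' δ c').1 hAB'
    have hcc : (inl (c'⁻¹ * c) : SD σ) = (inl c')⁻¹ * inl c := by rw [map_mul, map_inv]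
    have hTP : MulAut.conj (inl (c'⁻¹ * c) : SD σ) ((inl γ) ^ a * frobElt σ ^ (l : ℤ)) =
        (inl γ') ^ a * frobElt σ ^ (l : ℤ) := by
      rw [hcc, map_mul MulAut.conj, map_inv MulAut.conj, MulAut.mul_apply, hA, MulAut.inv_apply,
        MulEquiv.symm_apply_eq, hA']
    have hTQ : MulAut.conj (inl (c'⁻¹ * c) : SD σ) ((inl γ) ^ b * frobElt σ ^ (j : ℤ)) =
        (inl γ') ^ b * frobElt σ ^ (j : ℤ) := by
      rw [hcc, map_mul MulAut.conj, map_inv MulAut.conj, MulAut.mul_apply, hB, MulAut.inv_apply,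
        MulEquiv.symm_apply_eq, hB']
    obtain ⟨hx, hF⟩ := map_gen_of_map_pair (MulAut.conj (inl (c'⁻¹ * c) : SD σ)) (inl γ) (frobElt σ)
      (inl γ') (frobElt σ) hcomm hcomm' a l b j hd hTP hTQ
    refine ⟨c'⁻¹ * c, ?_, ?_⟩
    · rw [← pow_one (frobElt σ), conj_inl_F, inlF_eq_F_iff, mul_inv_eq_one, pow_one] at hF
      exact hF.symm
    · rw [conj_inl_inl, inl_inj] at hx
      exact hx.symm
  · rintro ⟨g, hg, hγ'⟩
    have hG : MulAut.conj (inl g : SD σ) (inl γ) = inl γ' := by rw [conj_inl_inl, hγ']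
    have hGF : MulAut.conj (inl g : SD σ) (frobElt σ) = frobElt σ := by
      rw [← pow_one (frobElt σ), conj_inl_F, inlF_eq_F_iff, mul_inv_eq_one, pow_one]
      exact hg.symm
    have hcg : (inl (c * g⁻¹) : SD σ) = inl c * (inl g)⁻¹ := by rw [map_mul, map_inv]
    refine ⟨c * g⁻¹, (condAB_iff_conj σ l j a b γ' δ _).2 ⟨?_, ?_⟩⟩
    · have hP' : (inl γ' : SD σ) ^ a * frobElt σ ^ (l : ℤ) =
          MulAut.conj (inl g) ((inl γ : SD σ) ^ a * frobElt σ ^ (l : ℤ)) := by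
        rw [map_mul, map_zpow, map_zpow, hG, hGF]
      rw [hcg, map_mul MulAut.conj, map_inv MulAut.conj, MulAut.mul_apply, hP', MulAut.inv_apply_self,
        hA]
    · have hQ' : (inl γ' : SD σ) ^ b * frobElt σ ^ (j : ℤ) =
          MulAut.conj (inl g) ((inl γ : SD σ) ^ b * frobElt σ ^ (j : ℤ)) := by
        rw [map_mul, map_zpow, map_zpow, hG, hGF]
      rw [hcg, map_mul MulAut.conj, map_inv MulAut.conj, MulAut.mul_apply, hQ', MulAut.inv_apply_self,
        hB]

/-- Common core of `FixedCosets_sigma` / `FixedCosets_sigmaPow`. [cite: Kottwitz1986BaseChangeUnits, §1 (p. 240)] -/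
theorem fixedCosets_aux (τ : MulAut GL) (KL : Subgroup GL) (hst : ∀ k ∈ KL, τ k ∈ KL)
    (hsurj : ∀ k' ∈ KL, ∃ k ∈ KL, k⁻¹ * τ k = k') (g : GL) :
    g⁻¹ * τ g ∈ KL ↔ ∃ h : GL, τ h = h ∧ h⁻¹ * g ∈ KL := by
  constructor
  · intro hg
    obtain ⟨k, hk, hkk⟩ := hsurj _ hg
    refine ⟨g * k⁻¹, ?_, by simpa using hk⟩
    have h1 : τ g = g * (k⁻¹ * τ k) := by rw [hkk]; group
    rw [map_mul, map_inv, h1]; group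
  · rintro ⟨h, hh, hk⟩
    have h1 : g⁻¹ * τ g = (h⁻¹ * g)⁻¹ * τ (h⁻¹ * g) := by
      rw [map_mul, map_inv, hh]; group
    rw [h1]
    exact KL.mul_mem (KL.inv_mem hk) (hst _ hk)

/-- PROOF of `FixedCosets_sigma` («(b) implies that the fixed point set of `σ` on `X_L` is `X`»). [cite: Kottwitz1986BaseChangeUnits, §1 (p. 240)] -/
theorem FixedCosets_sigma_holds : ∀ (σ : MulAut GL) (KL : Subgroup GL), FixedCosets_sigma σ KL := by
  intro σ KL hA hB g
  exact fixedCosets_aux σ KL (map_mem_of_KLCondA σ KL hA) hB g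

/-- PROOF of `FixedCosets_sigmaPow` («(c) implies that the fixed point set of `σ^l` on `X_L` is `X_E`»). [cite: Kottwitz1986BaseChangeUnits, §1 (p. 240)] -/
theorem FixedCosets_sigmaPow_holds :
    ∀ (σ : MulAut GL) (l : ℕ) (KL : Subgroup GL), FixedCosets_sigmaPow σ l KL := by
  intro σ l KL hA hC g
  exact fixedCosets_aux (σ ^ l) KL (pow_map_mem σ KL (map_mem_of_KLCondA σ KL hA) l) hC g

/-- PROOF of `exists_gamma_iff` («`γ` exists iff (D′) can be solved»). [cite: Kottwitz1986BaseChangeUnits, §1 (D′) (p. 242)] -/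
theorem exists_gamma_iff_holds : ∀ (σ : MulAut GL) (l j : ℕ) (a b : ℤ), exists_gamma_iff σ l j a b := by
  intro σ l j a b hd δ hδ
  constructor
  · rintro ⟨γ, hγ, c, hAB⟩
    have hcomm : Commute (inl γ : SD σ) (frobElt σ) := (commute_inl_frob_iff σ γ).2 hγ
    obtain ⟨hA, hB⟩ := (condAB_iff_conj σ l j a b γ δ c).1 hAB
    refine ⟨c, ?_⟩
    have hF : MulAut.conj (inl c : SD σ) (frobElt σ) =
        (inl δ * frobElt σ ^ (j : ℤ)) ^ (-a) * (frobElt σ ^ (l : ℤ)) ^ b := by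
      conv_lhs => rw [← pair_gen_snd (inl γ : SD σ) (frobElt σ) hcomm a l b j hd,
        ((pair_commute _ _ hcomm a l b j).zpow_zpow b (-a)).eq]
      rw [map_mul, map_zpow, map_zpow, hA, hB]
    have hDa : (inl δ * frobElt σ ^ (j : ℤ) : SD σ) ^ (-a) =
        MulAut.conj (inl c : SD σ) (frobElt σ) * ((frobElt σ ^ (l : ℤ)) ^ b)⁻¹ := by
      rw [hF, mul_inv_cancel_right]
    rw [← zpow_natCast (frobElt σ) j, hDa, ← zpow_mul, ← zpow_neg, mul_assoc, ← zpow_add,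
      show -((l : ℤ) * b) + a * j = -1 by linear_combination (-1 : ℤ) * hd, zpow_neg, zpow_one,
      conjF_mul_Finv]
  · rintro ⟨c, hc⟩
    -- `P̃ := c⁻¹ σ^l c`, `Q̃ := c⁻¹ (δσ^j) c` commute; `x := P̃^{-j} Q̃^{l}`, `y := P̃^{b} Q̃^{-a} = σ`.
    have hd' : b * (l : ℤ) - (-(j : ℤ)) * (-a) = 1 := by linear_combination hd
    have hPQ0 : Commute (frobElt σ ^ (l : ℤ)) (inl δ * frobElt σ ^ (j : ℤ) : SD σ) := by
      rw [zpow_natCast, zpow_natCast, commute_frobPow_inlF_iff]; exact hδ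
    have hPQ : Commute (MulAut.conj (inl c⁻¹ : SD σ) (frobElt σ ^ (l : ℤ)))
        (MulAut.conj (inl c⁻¹ : SD σ) (inl δ * frobElt σ ^ (j : ℤ))) := (commute_conj_iff _ _ _).2 hPQ0
    have hCinv : MulAut.conj (inl c⁻¹ : SD σ) = (MulAut.conj (inl c : SD σ))⁻¹ := by
      rw [map_inv (inl : GL →* SD σ), map_inv MulAut.conj]
    have hback : ∀ z : SD σ, MulAut.conj (inl c) (MulAut.conj (inl c⁻¹) z) = z := by
      intro z; rw [hCinv, MulAut.apply_inv_self]
    have hback' : ∀ z : SD σ, MulAut.conj (inl c⁻¹) (MulAut.conj (inl c) z) = z := by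
      intro z; rw [hCinv, MulAut.inv_apply_self]
    have hc' : (inl δ * frobElt σ ^ j : SD σ) ^ (-a) =
        inl (c * σ c⁻¹) * (frobElt σ ^ ((a : ℤ) * j))⁻¹ := by
      rw [← hc, mul_inv_cancel_right]
    -- y = σ
    have hy : (MulAut.conj (inl c⁻¹ : SD σ) (frobElt σ ^ (l : ℤ))) ^ b *
        (MulAut.conj (inl c⁻¹ : SD σ) (inl δ * frobElt σ ^ (j : ℤ))) ^ (-a) = frobElt σ := by
      rw [← map_zpow, ← map_zpow, ← map_mul, (hPQ0.zpow_zpow b (-a)).eq, zpow_natCast (frobElt σ) j,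
        hc', ← zpow_mul, ← zpow_neg, mul_assoc, ← zpow_add,
        show -((a : ℤ) * j) + l * b = 1 by linear_combination hd, zpow_one, ← conjF_mul_Finv,
        inv_mul_cancel_right, hback']
    have hxy := pair_commute _ _ hPQ (-(j : ℤ)) (l : ℤ) b (-a)
    rw [hy] at hxy
    -- x has trivial `⟨σ⟩`-component
    have hr1 : (MulAut.conj (inl c⁻¹ : SD σ) (frobElt σ ^ (l : ℤ))).right = Multiplicative.ofAdd (l : ℤ) := by
      rw [right_conj_inl, right_zpow, frobElt, right_inr, ← Int.ofAdd_mul, one_mul]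
    have hr2 : (MulAut.conj (inl c⁻¹ : SD σ) (inl δ * frobElt σ ^ (j : ℤ))).right =
        Multiplicative.ofAdd (j : ℤ) := by
      rw [right_conj_inl, zpow_natCast, inlF_right]
    have hxr : ((MulAut.conj (inl c⁻¹ : SD σ) (frobElt σ ^ (l : ℤ))) ^ (-(j : ℤ)) *
        (MulAut.conj (inl c⁻¹ : SD σ) (inl δ * frobElt σ ^ (j : ℤ))) ^ (l : ℤ)).right = 1 := by
      rw [mul_right, right_zpow, right_zpow, hr1, hr2, ← Int.ofAdd_mul, ← Int.ofAdd_mul, ← ofAdd_add,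
        ← ofAdd_zero]
      congr 1; ring
    have hx := eq_inl_of_right_eq_one σ _ hxr
    have hP' := pair_gen_fst _ _ hPQ (-(j : ℤ)) l b (-a) hd'
    have hQ' := pair_gen_snd _ _ hPQ (-(j : ℤ)) l b (-a) hd'
    rw [neg_neg, hy] at hP'
    rw [neg_neg, hy] at hQ'
    rw [hx] at hP' hQ' hxy
    exact ⟨_, (commute_inl_frob_iff σ _).1 hxy, c,
      (condAB_iff_conj σ l j a b _ δ c).2 ⟨by rw [hP', hback], by rw [hQ', hback]⟩⟩

/-- PROOF of `exists_delta_of_fixedCoset` («if `X^γ` is non-empty, then there exists `δ ∈ G(E)` such that `γ ↔ δ`»). [cite: Kottwitz1986BaseChangeUnits, §1 (p. 242)] -/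
theorem exists_delta_of_fixedCoset_holds : ∀ (σ : MulAut GL) (l j : ℕ) (a b : ℤ) (KL : Subgroup GL),
    exists_delta_of_fixedCoset σ l j a b KL := by
  rintro σ l j a b KL hd hKA hKB hKC γ hγ ⟨g, hg1, hg2⟩
  obtain ⟨h, hh, hhg⟩ := (FixedCosets_sigma_holds σ KL hKA hKB g).1 hg1
  have hγ'F : IsRatF σ (h⁻¹ * γ * h) := by
    unfold IsRatF at *; rw [map_mul, map_mul, map_inv, hh, hγ]
  have hγ'K : h⁻¹ * γ * h ∈ KL := by
    have e : h⁻¹ * γ * h = (h⁻¹ * g) * (g⁻¹ * γ * g) * (h⁻¹ * g)⁻¹ := by group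
    rw [e]; exact KL.mul_mem (KL.mul_mem hhg hg2) (KL.inv_mem hhg)
  obtain ⟨k, _hk, hkk⟩ := hKC _ (KL.zpow_mem hγ'K a)
  obtain ⟨δ, hδ, hcorr'⟩ := (exists_delta_iff_holds σ l j a b hd _ hγ'F).2 ⟨k, hkk.symm⟩
  exact ⟨δ, hδ, (corr_gamma_unique_holds σ l j a b hd _ γ δ hγ'F hγ hδ hcorr').2 ⟨h, hh, by group⟩⟩

/-- PROOF of `exists_gamma_of_fixedCoset` («if `X_E^{δθ}` is non-empty, then there exists `γ ∈ G(F)` such that `γ ↔ δ`»). [cite: Kottwitz1986BaseChangeUnits, §1 (p. 242)] -/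
theorem exists_gamma_of_fixedCoset_holds : ∀ (σ : MulAut GL) (l j : ℕ) (a b : ℤ) (KL : Subgroup GL),
    exists_gamma_of_fixedCoset σ l j a b KL := by
  rintro σ l j a b KL hd hKA hKB hKC δ hδ ⟨g, hg1, hg2⟩
  obtain ⟨h, hh, hhg⟩ := (FixedCosets_sigmaPow_holds σ l KL hKA hKC g).1 hg1
  have hδ'E : IsRatE σ l (h⁻¹ * δ * (σ ^ j) h) := by
    unfold IsRatE at *
    rw [map_mul, map_mul, map_inv, hh, hδ, ← MulAut.mul_apply, ← pow_add, add_comm, pow_add,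
      MulAut.mul_apply, hh]
  have hδ'K : h⁻¹ * δ * (σ ^ j) h ∈ KL := by
    have e : h⁻¹ * δ * (σ ^ j) h = (h⁻¹ * g) * (g⁻¹ * δ * (σ ^ j) g) * ((σ ^ j) (h⁻¹ * g))⁻¹ := by
      rw [map_mul, map_inv]; group
    rw [e]
    exact KL.mul_mem (KL.mul_mem hhg hg2)
      (KL.inv_mem (pow_map_mem σ KL (map_mem_of_KLCondA σ KL hKA) j _ hhg))
  -- the element `(δ'θ)^{-a} σ^{aj}` lies in `K_L ⋊ ⟨σ⟩` and has trivial `⟨σ⟩`-component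
  have hzS : (inl (h⁻¹ * δ * (σ ^ j) h) * frobElt σ ^ j) ^ (-a) * frobElt σ ^ ((a : ℤ) * j)
      ∈ liftSubgroup σ KL hKA := by
    refine (liftSubgroup σ KL hKA).mul_mem ((liftSubgroup σ KL hKA).zpow_mem ?_ _)
      ((liftSubgroup σ KL hKA).zpow_mem ?_ _)
    · rw [inlF_mem_liftSubgroup_iff]; exact hδ'K
    · rw [mem_liftSubgroup_iff, frobElt, left_inr]; exact KL.one_mem
  have hzr : ((inl (h⁻¹ * δ * (σ ^ j) h) * frobElt σ ^ j) ^ (-a) * frobElt σ ^ ((a : ℤ) * j) : SD σ).right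
      = 1 := by
    rw [mul_right, right_zpow, right_zpow, inlF_right, frobElt, right_inr, ← Int.ofAdd_mul, ← Int.ofAdd_mul,
      ← ofAdd_add, ← ofAdd_zero]
    congr 1; ring
  rw [mem_liftSubgroup_iff] at hzS
  obtain ⟨k, _hk, hkk⟩ := hKB _ hzS
  have hc : (inl (h⁻¹ * δ * (σ ^ j) h) * frobElt σ ^ j) ^ (-a) * frobElt σ ^ ((a : ℤ) * j)
      = (inl (k⁻¹ * σ k⁻¹⁻¹) : SD σ) := by
    rw [inv_inv, hkk]; exact eq_inl_of_right_eq_one σ _ hzr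
  obtain ⟨γ, hγ, hcorr'⟩ := (exists_gamma_iff_holds σ l j a b hd _ hδ'E).2 ⟨k⁻¹, hc⟩
  refine ⟨γ, hγ, (corr_delta_unique_holds σ l j a b hd γ _ δ hγ hδ'E hδ hcorr').2 ⟨h, hh, ?_⟩⟩
  group

/-- PROOF of `fixedCoset_transport` («`x ↦ cx` induces a bijection from `X^γ` to `X_E^{δθ}`»). [cite: Kottwitz1986BaseChangeUnits, §1 (p. 241)] -/
theorem fixedCoset_transport_holds : ∀ (σ : MulAut GL) (l j : ℕ) (a b : ℤ) (KL : Subgroup GL),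
    fixedCoset_transport σ l j a b KL := by
  intro σ l j a b KL hd hKA γ δ c hγ _hδ hAB g
  have hcomm : Commute (inl γ : SD σ) (frobElt σ) := (commute_inl_frob_iff σ γ).2 hγ
  obtain ⟨hA, hB⟩ := (condAB_iff_conj σ l j a b γ δ c).1 hAB
  have hTg : ∀ z : SD σ, (MulAut.conj (inl (c * g) : SD σ))⁻¹ z =
      (MulAut.conj (inl g : SD σ))⁻¹ ((MulAut.conj (inl c : SD σ))⁻¹ z) := by
    intro z; rw [map_mul, map_mul MulAut.conj, mul_inv_rev, MulAut.mul_apply]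
  have m1 : g⁻¹ * σ g ∈ KL ↔ (MulAut.conj (inl g : SD σ))⁻¹ (frobElt σ) ∈ liftSubgroup σ KL hKA := by
    rw [← pow_one (frobElt σ), conjInv_F, inlF_mem_liftSubgroup_iff, pow_one]
  have m2 : g⁻¹ * γ * g ∈ KL ↔ (MulAut.conj (inl g : SD σ))⁻¹ (inl γ) ∈ liftSubgroup σ KL hKA := by
    rw [conjInv_inl, inl_mem_liftSubgroup_iff]
  have m3 : (MulAut.conj (inl g : SD σ))⁻¹ ((inl γ) ^ a * frobElt σ ^ (l : ℤ)) ∈ liftSubgroup σ KL hKA ↔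
      (c * g)⁻¹ * (σ ^ l) (c * g) ∈ KL := by
    rw [← MulAut.inv_apply_self _ (MulAut.conj (inl c : SD σ)) ((inl γ) ^ a * frobElt σ ^ (l : ℤ)), hA,
      ← hTg, zpow_natCast, conjInv_F, inlF_mem_liftSubgroup_iff]
  have m4 : (MulAut.conj (inl g : SD σ))⁻¹ ((inl γ) ^ b * frobElt σ ^ (j : ℤ)) ∈ liftSubgroup σ KL hKA ↔
      (c * g)⁻¹ * δ * (σ ^ j) (c * g) ∈ KL := by
    rw [← MulAut.inv_apply_self _ (MulAut.conj (inl c : SD σ)) ((inl γ) ^ b * frobElt σ ^ (j : ℤ)), hB,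
      ← hTg, zpow_natCast, conjInv_inlF, inlF_mem_liftSubgroup_iff]
  rw [m1, m2, ← m3, ← m4]
  exact map_mem_pair_iff (liftSubgroup σ KL hKA) _ (inl γ) (frobElt σ) hcomm a l b j hd

end Discharges

end Literature.NumberTheory.Kottwitz1986BaseChangeUnits.MainResult
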